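import Mathlib
import HarnessLib
import Summits.MatrixMultiplication.Statement
import Summits.MatrixMultiplication.MatrixMultiplication.Theses.FarEdgeDescent
import Literature.Computability.AlgebraicComplexity.GroupTheoreticMatMul
import Literature.Computability.AlgebraicComplexity.GroupTheoreticMatMulProofs
import Literature.Computability.AlgebraicComplexity.GroupTheoreticMatMulThmBProofs
import Literature.Computability.AlgebraicComplexity.AsymptoticSumInequality
import Literature.Computability.AlgebraicComplexity.SchonhageRectangular

/-!
# FarEdgeDescent — Kernel LI (lens-2 «structural dichotomy», gen 67): ABELIAN STPP SATURATION —
# the second restriction mechanism for the special crux, and its slice-rank kill window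

Support module (def-free, sorry-free) for the special crux `FiniteSaturation`
(stmt-MatrixMultiplication-23739, `∃ k ≥ 2, ω(1,k,1) = k + 1`) of
`Summits/MatrixMultiplication/MatrixMultiplication/Theses/FarEdgeDescent.lean`; the cut of record
`closes (h₁ : FiniteSaturation) (h₂ : AnchoredLogConvexity)` is UNCHANGED and nothing here enters it.
It is the ONE typed output the critic admitted for gen 67 (STATUS l.3328, option (ii)): the abelian
SIMULTANEOUS-TPP named-family sufficiency for `h₁` together with its tricolored-sum-free /
slice-rank kill at the skinny format, as a theorem pair.  Companion of Kernel L (gen 66,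
`FarEdgeDescentTPPSaturation`: the single-TPP mechanism in arbitrary finite groups, where abelian
groups are excluded outright by Cohn–Umans Lemma 3.1); here the group is ABELIAN and the content
is in the SIMULTANEITY of `s → ∞` triples (CKSU 2005 §5, the USP / two-families regime).

Write `STPPSat_k` for: «for every `ε > 0` some finite abelian group `H` carries an STPP family
(CKSU 2005 Def. 5.1 = BCCGNSU 2017 Def. 2.2; tree `IsSTPP`) of `s ≥ 1` triples of the common
format `(|Aᵢ|, |Bᵢ|, |Cᵢ|) = (a, a^k, a)`, `a ≥ 2`, with `|H| ≤ s · a^{(k+1)(1+ε)}`», and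
`STPPSat_k^{≤ℓ}` for the same with `H` of exponent `≤ ℓ`.

* §0 `tensorRank_multiple_le_card_of_isSTPP` — the reduction `R(⟨s⟩ ⊗ ⟨a,b,c⟩) ≤ |H|` for a
  uniform STPP family (CKSU Thm. 5.3, tree `tensorRank_matMulDirectSum_le_card_of_isSTPP`, and
  block extraction `tensorRank_multiple_le_kroneckerPow_matMulDirectSum` at power `1`).
* §1 ★★ `finiteSaturation_of_stpp` — **`STPPSat_k ⟹ h₁`** (`k ≥ 2`): Schönhage's rectangular
  asymptotic sum inequality `s · a^{ω(1,k,1)} ≤ R̃(⟨s⟩ ⊗ ⟨a, a^k, a⟩)`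
  (`mul_rpow_omegaRect_mid_le_asymptoticRank`), `R̃ ≤ R ≤ |H| ≤ s · a^{(k+1)(1+ε)}`, so
  `ω(1,k,1) ≤ (k+1)(1+ε)` for every `ε` (`omegaRect_le_of_stpp_budget`), and `ω(1,k,1) ≥ k+1`
  (`add_one_le_omegaRect_one_mid_one`).  No host / border-rank dictionary is used: the conclusion
  is `ω(1,k,1) = k+1` by name.  (The RANK shadow «`R(⟨s⟩ ⊗ ⟨a,a^k,a⟩) ≤ s·a^{(k+1)(1+ε)}`» is `h₁`
  again at `s = 1`; only the combinatorial form has content — gen 66 §3 (v).)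
* §2 the screens a witness family passes (typed): `pow_le_card_of_isSTPP` `a^{k+2} ≤ |H|` (each
  triple is a TPP triple, Cohn–Umans Lemma 3.1), whence `rpow_le_card_pieces_of_stpp_budget`
  **`s ≥ a^{1-(k+1)ε}`** — the pieces are MANY; `mul_pow_le_card_of_isSTPP` **`s · a^{k+1} ≤ |H|`**
  (packing bound `∑|Aᵢ||Bᵢ| ≤ |H|`, BCCGNSU §2) — with the budget, the `(A,B)`-packing fills `H`
  up to the factor `a^{(k+1)ε}`: near-PERFECT packing, the uniquely-solvable-puzzle regime.
* §3 the barrier pair: `exists_stpp_skinny_rpow_le` — for every `ℓ` a `δ = δ_ℓ ∈ (0,1)` with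
  **`s · a^{2(k+2)/3} ≤ |H|^{1-δ}`** for every skinny STPP family in exponent `≤ ℓ` (the tree's
  effective Thm. B `AddSimultaneousTPP.exists_sum_rpow_le`, i.e. BCCGNSU §3.2: symmetrise in
  `(H^N)^3`, extract a uniform square sub-family, apply Thm. A; read at constant volume `a^{k+2}`);
  `rpow_pieces_le_of_barrier_of_budget` — with the budget this is the THRESHOLD
  **`s^δ ≤ a^{(k+1)(1+ε)(1-δ) - 2(k+2)/3}`**; ★★ `not_stppSaturation_boundedExponent_manyPieces` —
  for every `σ` with `σδ > (k+1)(1-δ) - 2(k+2)/3`, the sub-form of `STPPSat_k^{≤ℓ}` with `s ≥ a^σ`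
  pieces is REFUTED; ★ `not_stppSaturation_boundedExponent_of_lt` — if
  `δ_ℓ > (k-1)/(3(k+2))` (i.e. `(k+1)(1-δ) - 2(k+2)/3 < δ`) then `STPPSat_k^{≤ℓ}` is refuted
  OUTRIGHT, because §2 forces `σ ≥ 1 - (k+1)ε`.
Correction of the gen-66 memo threshold `s^δ ≷ a^{(k+1)(1-δ)-2}` (which used the asymptotic
subrank `a²` of the skinny piece directly): the symmetrised exponent `2(k+2)/3` exceeds `2` for
every `k > 1` (`Q̃` is super-multiplicative: `⟨a,B,a⟩ ⊗ ⟨B,a,a⟩ ⊗ ⟨a,a,B⟩ = ⟨a²B, a²B, a²B⟩` has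
subrank `a⁴B² > a⁶`), so the tree's Thm. B gives the SHARPER kill, and it is the one typed here.

THE WINDOW (what is decided and what is not).  In bounded exponent `≤ ℓ` a witness family lives in
`a^{1-(k+1)ε} ≤ s ≤ a^{((k+1)(1+ε)(1-δ_ℓ) - 2(k+2)/3)/δ_ℓ}`; the window is EMPTY iff
`δ_ℓ > (k-1)/(3(k+2))` (`= 1/12` at `k = 2`, `→ 1/3`), non-empty for the small savings `δ_ℓ` the
weak Thm. A provides at large `ℓ`; in groups of UNBOUNDED exponent (cyclic groups have full slice
rank, BCCGNSU App. B) the barrier is silent.  So `STPPSat_k` is SUFFICIENT · named-family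
`{ℂ[H] : H abelian, STPP}` · UNDECIDED · BARRIER-PLACED (TricoloredSumFree bites exactly the
many-pieces corner typed in §3).  Dichotomy reading (the lens): SPECIAL = bounded exponent, where
slice rank decides the many-pieces corner and leaves a finite window; GENERIC = unbounded exponent
(ℤ/N-like), where the two-families / USP question of CKSU 2005 is open in print and nothing typed
bites.  Nothing here proves `ω = 2` or the crux; no definitions (gate rule D-0009).

[cite: CohnKleinbergSzegedyUmans2005, Def. 5.1, Thm. 5.3, Thm. 5.5, §5]
[cite: BlasiakChurchCohnGrochowNaslundSawinUmans2017, Def. 2.2, §2, Thm. A, Thm. B, Lemma 3.5,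
§3.2, App. B] [cite: CohnUmans2003, Lemma 3.1]
[cite: AlmanDuanVassilevskaWilliamsXuXuZhou2025, Thm. 3.2] [cite: Blaser2013, Thm. 7.5]
Written by the decomp-mm lens-2 planner seat (gen 67); imports only BUILT modules.
-/

namespace Summit.MatrixMultiplication.MatrixMultiplication.Theorems.FarEdgeDescentSTPPSaturation

open Literature.Computability.AlgebraicComplexity
open Summit.MatrixMultiplication.MatrixMultiplication.Theses.FarEdgeDescent

/-! ## §0 The reduction: a uniform STPP family bounds the rank of the multiple `⟨s⟩ ⊗ ⟨a, b, c⟩` -/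

/-- **`R(⟨s⟩ ⊗ ⟨a, b, c⟩) ≤ |H|`** for an STPP family of `s` triples of the common format
`(|Aᵢ|, |Bᵢ|, |Cᵢ|) = (a, b, c)` in a finite abelian group `H`: CKSU 2005 Thm. 5.3
(`R(⊕ᵢ ⟨|Aᵢ|,|Bᵢ|,|Cᵢ|⟩) ≤ R(ℂ[H]) = |H|`, tree `tensorRank_matMulDirectSum_le_card_of_isSTPP`) and
block extraction at tensor power `1` (`tensorRank_multiple_le_kroneckerPow_matMulDirectSum`).
[cite: CohnKleinbergSzegedyUmans2005, Thm. 5.3] -/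
theorem tensorRank_multiple_le_card_of_isSTPP {H : Type} [AddCommGroup H] [Fintype H]
    [DecidableEq H] {s a b c : ℕ} {A B C : Fin s → Finset H} (hS : IsSTPP A B C)
    (hcard : ∀ i, (A i).card = a ∧ (B i).card = b ∧ (C i).card = c) :
    tensorRank (kroneckerTensor (unitTensor ℂ s) (matMulTensor ℂ a b c)) ≤ Fintype.card H := by
  have h1 := tensorRank_multiple_le_kroneckerPow_matMulDirectSum ℂ (fun i => (A i).card)
    (fun i => (B i).card) (fun i => (C i).card) (N := 1) (K' := a) (M' := b) (N' := c)
    (fun β : Fin s => fun _ : Fin 1 => β) (fun β β' h => by simpa using congr_fun h 0)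
    (fun β => by simp [(hcard β).1]) (fun β => by simp [(hcard β).2.1])
    (fun β => by simp [(hcard β).2.2])
  refine h1.trans ((tensorRank_kroneckerPow_le _ 1).trans ?_)
  rw [pow_one]
  exact tensorRank_matMulDirectSum_le_card_of_isSTPP A B C hS

/-! ## §1 Abelian STPP saturation ⟹ `FiniteSaturation` -/

/-- **`s · a^{ω(1,k,1)} ≤ |H|`** for an abelian STPP family of `s ≥ 1` copies of the skinny format
`⟨a, a^k, a⟩` (`a ≥ 2`): Schönhage's asymptotic sum inequality in the middle-slot rectangular form
`s · a^{ω(1,k,1)} ≤ R̃(⟨s⟩ ⊗ ⟨a, a^k, a⟩)` (tree `mul_rpow_omegaRect_mid_le_asymptoticRank`),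
`R̃ ≤ R`, and §0. [cite: CohnKleinbergSzegedyUmans2005, Thm. 5.5]
[cite: AlmanDuanVassilevskaWilliamsXuXuZhou2025, Thm. 3.2] -/
theorem mul_rpow_omegaRect_le_card_of_isSTPP {H : Type} [AddCommGroup H] [Fintype H]
    [DecidableEq H] {k s a : ℕ} {A B C : Fin s → Finset H} (hS : IsSTPP A B C) (hs : 1 ≤ s)
    (ha : 2 ≤ a) (hcard : ∀ i, (A i).card = a ∧ (B i).card = a ^ k ∧ (C i).card = a) :
    (s : ℝ) * (a : ℝ) ^ omegaRect ℂ 1 k 1 ≤ Fintype.card H := by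
  have h1 := mul_rpow_omegaRect_mid_le_asymptoticRank ℂ (k := (k : ℝ)) (Nat.cast_nonneg k) hs ha
    (B := a ^ k) (by rw [Real.rpow_natCast]; push_cast; exact le_rfl)
  refine h1.trans ((asymptoticRank_le_tensorRank_pow_one _).trans ?_)
  have h3 := tensorRank_kroneckerPow_le
    (kroneckerTensor (unitTensor ℂ s) (matMulTensor ℂ a (a ^ k) a)) 1
  rw [pow_one] at h3
  exact_mod_cast h3.trans (tensorRank_multiple_le_card_of_isSTPP hS hcard)

/-- With the budget `|H| ≤ s · a^{(k+1)(1+ε)}`: **`ω(1,k,1) ≤ (k+1)(1+ε)`**. [cite: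
CohnKleinbergSzegedyUmans2005, Thm. 5.5] -/
theorem omegaRect_le_of_stpp_budget {H : Type} [AddCommGroup H] [Fintype H] [DecidableEq H]
    {k s a : ℕ} {A B C : Fin s → Finset H} {ε : ℝ} (hS : IsSTPP A B C) (hs : 1 ≤ s) (ha : 2 ≤ a)
    (hcard : ∀ i, (A i).card = a ∧ (B i).card = a ^ k ∧ (C i).card = a)
    (hH : (Fintype.card H : ℝ) ≤ s * (a : ℝ) ^ (((k : ℝ) + 1) * (1 + ε))) :
    omegaRect ℂ 1 k 1 ≤ ((k : ℝ) + 1) * (1 + ε) := by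
  have h := (mul_rpow_omegaRect_le_card_of_isSTPP hS hs ha hcard).trans hH
  have hs0 : (0 : ℝ) < s := by exact_mod_cast hs
  have ha1 : (1 : ℝ) < a := by exact_mod_cast ha
  exact (Real.rpow_le_rpow_left_iff ha1).mp (le_of_mul_le_mul_left h hs0)

/-- ★★ **Abelian STPP saturation implies the special crux.**  If for some `k ≥ 2` and every
tolerance `ε > 0` some finite abelian group `H` carries an STPP family (CKSU 2005 Def. 5.1, tree
`IsSTPP`) of `s ≥ 1` triples of the common skinny format `(a, a^k, a)`, `a ≥ 2`, with
`|H| ≤ s · a^{(k+1)(1+ε)}`, then `ω(1,k,1) = k + 1`, i.e. `FiniteSaturation`.  Mechanism: a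
combinatorial RESTRICTION `⊕^s ⟨a, a^k, a⟩ ≤ ℂ[H]` (not a degeneration), the rectangular asymptotic
sum inequality, and the information bound `ω(1,k,1) ≥ k + 1`.
[cite: CohnKleinbergSzegedyUmans2005, Def. 5.1, Thm. 5.3, Thm. 5.5]
[cite: AlmanDuanVassilevskaWilliamsXuXuZhou2025, Thm. 3.2] -/
theorem finiteSaturation_of_stpp {k : ℕ} (hk : 2 ≤ k)
    (h : ∀ ε : ℝ, 0 < ε → ∃ (H : Type) (_ : AddCommGroup H) (_ : Fintype H) (_ : DecidableEq H)
      (s a : ℕ) (A B C : Fin s → Finset H), 1 ≤ s ∧ 2 ≤ a ∧ IsSTPP A B C ∧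
        (∀ i, (A i).card = a ∧ (B i).card = a ^ k ∧ (C i).card = a) ∧
        (Fintype.card H : ℝ) ≤ s * (a : ℝ) ^ (((k : ℝ) + 1) * (1 + ε))) :
    FiniteSaturation := by
  refine ⟨k, hk, le_antisymm ?_ (add_one_le_omegaRect_one_mid_one ℂ (k : ℝ))⟩
  refine le_of_forall_pos_le_add fun ε hε => ?_
  have hκ : (0 : ℝ) < (k : ℝ) + 1 := by positivity
  obtain ⟨H, _, _, _, s, a, A, B, C, hs, ha, hS, hcard, hH⟩ :=
    h (ε / ((k : ℝ) + 1)) (by positivity)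
  calc omegaRect ℂ 1 k 1 ≤ ((k : ℝ) + 1) * (1 + ε / ((k : ℝ) + 1)) :=
        omegaRect_le_of_stpp_budget hS hs ha hcard hH
    _ = (k : ℝ) + 1 + ε := by
        rw [mul_add, mul_one, mul_div_cancel₀ ε hκ.ne']

/-! ## §2 The screens a witness family must pass: strict shortage of room -/

/-- **`a^{k+2} ≤ |H|`**: each triple of an abelian STPP family has the triple product property, so
`|Aᵢ||Bᵢ||Cᵢ| ≤ |H|` (Cohn–Umans 2003, Lemma 3.1; tree
`AddSimultaneousTPP.card_mul_card_mul_card_le`). [cite: CohnUmans2003, Lemma 3.1] -/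
theorem pow_le_card_of_isSTPP {H : Type} [AddCommGroup H] [Fintype H] [DecidableEq H]
    {k s a : ℕ} {A B C : Fin s → Finset H} (hS : IsSTPP A B C) (hs : 1 ≤ s)
    (hcard : ∀ i, (A i).card = a ∧ (B i).card = a ^ k ∧ (C i).card = a) :
    a ^ (k + 2) ≤ Fintype.card H := by
  have h := ((isSTPP_iff_addSimultaneousTPP A B C).1 hS).card_mul_card_mul_card_le ⟨0, hs⟩
  obtain ⟨hA, hB, hC⟩ := hcard ⟨0, hs⟩
  rw [hA, hB, hC] at h
  calc a ^ (k + 2) = a * a ^ k * a := by ring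
    _ ≤ Fintype.card H := h

/-- **`s · a^{k+1} ≤ |H|`** (near-perfect packing is forced): the packing bound
`∑ᵢ |Aᵢ||Bᵢ| ≤ |H|` of an STPP family with nonempty `Cᵢ` (BCCGNSU 2017 §2; tree
`AddSimultaneousTPP.sum_card_mul_card_le`).  With the budget `|H| ≤ s · a^{(k+1)(1+ε)}` the
`(A, B)`-packing fills `H` up to the factor `a^{(k+1)ε}` — the uniquely-solvable-puzzle regime.
[cite: BlasiakChurchCohnGrochowNaslundSawinUmans2017, §2] -/
theorem mul_pow_le_card_of_isSTPP {H : Type} [AddCommGroup H] [Fintype H] [DecidableEq H]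
    {k s a : ℕ} {A B C : Fin s → Finset H} (hS : IsSTPP A B C) (ha : 2 ≤ a)
    (hcard : ∀ i, (A i).card = a ∧ (B i).card = a ^ k ∧ (C i).card = a) :
    s * a ^ (k + 1) ≤ Fintype.card H := by
  have hS' := (isSTPP_iff_addSimultaneousTPP A B C).1 hS
  have hne : ∀ i, (C i).Nonempty := fun i =>
    Finset.card_pos.1 (by rw [(hcard i).2.2]; omega)
  have h := hS'.sum_card_mul_card_le hne
  have hAB : ∀ i, (A i).card * (B i).card = a ^ (k + 1) := fun i => by
    rw [(hcard i).1, (hcard i).2.1]; ring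
  simp_rw [hAB, Finset.sum_const, Finset.card_univ, Fintype.card_fin, smul_eq_mul] at h
  exact h

/-- **The pieces are many**: under the budget, `a^{1-(k+1)ε} ≤ s` (from `a^{k+2} ≤ |H| ≤
s · a^{(k+1)(1+ε)}`).  So a witness family at exponent `k` has `s → ∞` essentially as fast as `a`.
[cite: CohnUmans2003, Lemma 3.1] -/
theorem rpow_le_card_pieces_of_stpp_budget {H : Type} [AddCommGroup H] [Fintype H]
    [DecidableEq H] {k s a : ℕ} {A B C : Fin s → Finset H} {ε : ℝ} (hS : IsSTPP A B C)
    (hs : 1 ≤ s) (ha : 2 ≤ a)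
    (hcard : ∀ i, (A i).card = a ∧ (B i).card = a ^ k ∧ (C i).card = a)
    (hH : (Fintype.card H : ℝ) ≤ s * (a : ℝ) ^ (((k : ℝ) + 1) * (1 + ε))) :
    (a : ℝ) ^ (1 - ((k : ℝ) + 1) * ε) ≤ s := by
  have ha0 : (0 : ℝ) < a := by exact_mod_cast (by omega : 0 < a)
  have h1 : ((a ^ (k + 2) : ℕ) : ℝ) ≤ Fintype.card H := by
    exact_mod_cast pow_le_card_of_isSTPP hS hs hcard
  have h2 : (a : ℝ) ^ ((k : ℝ) + 2) ≤ s * (a : ℝ) ^ (((k : ℝ) + 1) * (1 + ε)) := by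
    have : (a : ℝ) ^ ((k : ℝ) + 2) = ((a ^ (k + 2) : ℕ) : ℝ) := by
      rw [show (k : ℝ) + 2 = ((k + 2 : ℕ) : ℝ) by push_cast; ring, Real.rpow_natCast]; push_cast; rfl
    rw [this]; exact h1.trans hH
  have hsplit : (a : ℝ) ^ ((k : ℝ) + 2) =
      (a : ℝ) ^ (1 - ((k : ℝ) + 1) * ε) * (a : ℝ) ^ (((k : ℝ) + 1) * (1 + ε)) := by
    rw [← Real.rpow_add ha0]; ring_nf
  rw [hsplit] at h2
  exact le_of_mul_le_mul_right h2 (Real.rpow_pos_of_pos ha0 _)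

/-! ## §3 The slice-rank barrier at the skinny format: the kill window -/

/-- **The tricolored-sum-free barrier at the skinny format.**  For every `ℓ` there is
`δ ∈ (0,1)` such that every abelian STPP family of `s` copies of `⟨a, a^k, a⟩` in a group of
exponent `≤ ℓ` satisfies `s · a^{2(k+2)/3} ≤ |H|^{1-δ}`.  This is the tree's effective Thm. B
`AddSimultaneousTPP.exists_sum_rpow_le` (`∑ᵢ (|Aᵢ||Bᵢ||Cᵢ|)^{2/3} ≤ |H|^{1-δ_ℓ}`, BCCGNSU 2017
§3.2: symmetrise the family in `(H^N)^3`, extract a uniform square sub-family, Thm. A) read at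
constant volume `a^{k+2}` (shrinking `δ` keeps the bound as `|H| ≥ 1`, whence `δ < 1`).
[cite: BlasiakChurchCohnGrochowNaslundSawinUmans2017, Thm. A, Thm. B, Lemma 3.5] -/
theorem exists_stpp_skinny_rpow_le (ℓ : ℕ) : ∃ δ : ℝ, 0 < δ ∧ δ < 1 ∧
    ∀ (H : Type) [AddCommGroup H] [Fintype H] [DecidableEq H], AddMonoid.exponent H ≤ ℓ →
      ∀ (k s a : ℕ) (A B C : Fin s → Finset H), IsSTPP A B C →
        (∀ i, (A i).card = a ∧ (B i).card = a ^ k ∧ (C i).card = a) →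
          (s : ℝ) * (a : ℝ) ^ (2 * ((k : ℝ) + 2) / 3) ≤ (Fintype.card H : ℝ) ^ (1 - δ) := by
  obtain ⟨δ, hδ, hmain⟩ :=
    Literature.Combinatorics.Additive.AddSimultaneousTPP.exists_sum_rpow_le ℓ
  refine ⟨min δ (1 / 2), lt_min hδ one_half_pos,
    (min_le_right _ _).trans_lt one_half_lt_one, fun H _ _ _ hexp k s a A B C hS hcard => ?_⟩
  have h := hmain H hexp (Fin s) A B C ((isSTPP_iff_addSimultaneousTPP A B C).1 hS)
  have hvol : ∀ i, ((((A i).card * (B i).card * (C i).card : ℕ) : ℝ)) ^ ((2 : ℝ) / 3) =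
      (a : ℝ) ^ (2 * ((k : ℝ) + 2) / 3) := by
    intro i
    rw [(hcard i).1, (hcard i).2.1, (hcard i).2.2,
      show (a * a ^ k * a : ℕ) = a ^ (k + 2) by ring]
    push_cast
    rw [← Real.rpow_natCast, ← Real.rpow_mul (Nat.cast_nonneg a)]
    push_cast
    ring_nf
  simp_rw [hvol, Finset.sum_const, Finset.card_univ, Fintype.card_fin, nsmul_eq_mul] at h
  have hH1 : (1 : ℝ) ≤ Fintype.card H := by exact_mod_cast Fintype.card_pos
  exact h.trans (Real.rpow_le_rpow_of_exponent_le hH1 (by linarith [min_le_left δ (1 / 2)]))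

/-- **The threshold.**  From the barrier inequality `s · a^{2(k+2)/3} ≤ |H|^{1-δ}` (`δ < 1`) and the
budget `|H| ≤ s · a^{(k+1)(1+ε)}`: `s^δ ≤ a^{(k+1)(1+ε)(1-δ) - 2(k+2)/3}` (pure arithmetic).  So a
bounded-exponent witness can only live in the window
`a^{1-(k+1)ε} ≤ s ≤ a^{((k+1)(1+ε)(1-δ) - 2(k+2)/3)/δ}` (§2 for the lower end).
[cite: BlasiakChurchCohnGrochowNaslundSawinUmans2017, Thm. B] -/
theorem rpow_pieces_le_of_barrier_of_budget {δ X X' : ℝ} {k s a : ℕ} (hδ1 : δ < 1)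
    (hs : 1 ≤ s) (ha : 1 ≤ a)
    (hbar : (s : ℝ) * (a : ℝ) ^ (2 * ((k : ℝ) + 2) / 3) ≤ X ^ (1 - δ)) (hX0 : 0 ≤ X)
    (hH : X ≤ s * (a : ℝ) ^ X') :
    (s : ℝ) ^ δ ≤ (a : ℝ) ^ (X' * (1 - δ) - 2 * ((k : ℝ) + 2) / 3) := by
  have hs0 : (0 : ℝ) < s := by exact_mod_cast hs
  have ha0 : (0 : ℝ) < a := by exact_mod_cast ha
  have h1 : X ^ (1 - δ) ≤ ((s : ℝ) * (a : ℝ) ^ X') ^ (1 - δ) :=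
    Real.rpow_le_rpow hX0 hH (by linarith)
  rw [Real.mul_rpow hs0.le (Real.rpow_nonneg ha0.le _), ← Real.rpow_mul ha0.le] at h1
  have h2 := hbar.trans h1
  have hsplit : (s : ℝ) = (s : ℝ) ^ δ * (s : ℝ) ^ (1 - δ) := by
    rw [← Real.rpow_add hs0]; norm_num
  rw [Real.rpow_sub ha0, le_div_iff₀ (Real.rpow_pos_of_pos ha0 _)]
  have h3 : (s : ℝ) ^ δ * (a : ℝ) ^ (2 * ((k : ℝ) + 2) / 3) * (s : ℝ) ^ (1 - δ) ≤
      (a : ℝ) ^ (X' * (1 - δ)) * (s : ℝ) ^ (1 - δ) := by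
    calc (s : ℝ) ^ δ * (a : ℝ) ^ (2 * ((k : ℝ) + 2) / 3) * (s : ℝ) ^ (1 - δ)
        = (s : ℝ) * (a : ℝ) ^ (2 * ((k : ℝ) + 2) / 3) := by
          conv_rhs => rw [hsplit]
          ring
      _ ≤ (s : ℝ) ^ (1 - δ) * (a : ℝ) ^ (X' * (1 - δ)) := h2
      _ = (a : ℝ) ^ (X' * (1 - δ)) * (s : ℝ) ^ (1 - δ) := mul_comm _ _
  exact le_of_mul_le_mul_right h3 (Real.rpow_pos_of_pos hs0 _)

/-- ★★ **Kill in the regime the barrier bites: MANY PIECES.**  For every `ℓ` there is `δ ∈ (0,1)`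
(the slice-rank saving at exponent `≤ ℓ`) such that for every `k` and every piece-count exponent
`σ` with `σ·δ > (k+1)(1-δ) - 2(k+2)/3`, NO family of tolerance-`ε` witnesses of abelian STPP
saturation at exponent `k` in groups of exponent `≤ ℓ` with `s ≥ a^σ` pieces exists for all
`ε > 0`: at `ε = g/(2(k+1))`, `g` the gap, `a^{σδ} ≤ s^δ ≤ a^{(k+1)(1+ε)(1-δ) - 2(k+2)/3}` forces
`g ≤ g(1-δ)/2`. [cite: BlasiakChurchCohnGrochowNaslundSawinUmans2017, Thm. B] -/
theorem not_stppSaturation_boundedExponent_manyPieces (ℓ : ℕ) : ∃ δ : ℝ, 0 < δ ∧ δ < 1 ∧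
    ∀ (k : ℕ) (σ : ℝ), ((k : ℝ) + 1) * (1 - δ) - 2 * ((k : ℝ) + 2) / 3 < σ * δ →
      ¬ (∀ ε : ℝ, 0 < ε → ∃ (H : Type) (_ : AddCommGroup H) (_ : Fintype H) (_ : DecidableEq H)
          (s a : ℕ) (A B C : Fin s → Finset H), AddMonoid.exponent H ≤ ℓ ∧ 1 ≤ s ∧ 2 ≤ a ∧
            IsSTPP A B C ∧ (∀ i, (A i).card = a ∧ (B i).card = a ^ k ∧ (C i).card = a) ∧
            (a : ℝ) ^ σ ≤ s ∧
            (Fintype.card H : ℝ) ≤ s * (a : ℝ) ^ (((k : ℝ) + 1) * (1 + ε))) := by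
  obtain ⟨δ, hδ, hδ1, hbar⟩ := exists_stpp_skinny_rpow_le ℓ
  refine ⟨δ, hδ, hδ1, fun k σ hσ h => ?_⟩
  set κ : ℝ := (k : ℝ) + 1 with hκdef
  have hκ : 0 < κ := by positivity
  set g : ℝ := σ * δ - (κ * (1 - δ) - 2 * ((k : ℝ) + 2) / 3) with hgdef
  have hg : 0 < g := by rw [hgdef]; linarith
  obtain ⟨H, _, _, _, s, a, A, B, C, hexp, hs, ha, hS, hcard, hσs, hH⟩ :=
    h (g / (2 * κ)) (by positivity)
  have ha0 : (0 : ℝ) < a := by exact_mod_cast (by omega : 0 < a)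
  have ha1 : (1 : ℝ) < a := by exact_mod_cast ha
  have h1 := hbar H hexp k s a A B C hS hcard
  have h2 := rpow_pieces_le_of_barrier_of_budget hδ1 hs (by omega) h1 (Nat.cast_nonneg _) hH
  have h3 : (a : ℝ) ^ (σ * δ) ≤ (s : ℝ) ^ δ := by
    rw [Real.rpow_mul ha0.le]
    exact Real.rpow_le_rpow (Real.rpow_nonneg ha0.le _) hσs hδ.le
  have h5 : σ * δ ≤ κ * (1 + g / (2 * κ)) * (1 - δ) - 2 * ((k : ℝ) + 2) / 3 :=
    (Real.rpow_le_rpow_left_iff ha1).mp (h3.trans h2)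
  have h6 : κ * (1 + g / (2 * κ)) = κ + g / 2 := by
    rw [mul_add, mul_one, mul_div_assoc', mul_comm κ g, mul_div_mul_right g 2 hκ.ne']
  rw [h6] at h5
  nlinarith [h5, hg, hδ, hδ1]

/-- ★ **Kill of the plain form when the saving is large.**  With `δ` as above: for every `k` with
`(k+1)(1-δ) - 2(k+2)/3 < δ`, i.e. `δ_ℓ > (k-1)/(3(k+2))`, abelian STPP saturation at exponent `k`
in groups of exponent `≤ ℓ` fails outright — the packing screen of §2 supplies `s ≥ a^{1-(k+1)ε}`,
which lands in the killed range for small `ε`.  For `δ_ℓ ≤ (k-1)/(3(k+2))` the window of §3 is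
non-empty and the barrier is silent there; groups of unbounded exponent are untouched throughout.
[cite: BlasiakChurchCohnGrochowNaslundSawinUmans2017, Thm. B] [cite: CohnUmans2003, Lemma 3.1] -/
theorem not_stppSaturation_boundedExponent_of_lt (ℓ : ℕ) : ∃ δ : ℝ, 0 < δ ∧ δ < 1 ∧
    ∀ (k : ℕ), ((k : ℝ) + 1) * (1 - δ) - 2 * ((k : ℝ) + 2) / 3 < δ →
      ¬ (∀ ε : ℝ, 0 < ε → ∃ (H : Type) (_ : AddCommGroup H) (_ : Fintype H) (_ : DecidableEq H)
          (s a : ℕ) (A B C : Fin s → Finset H), AddMonoid.exponent H ≤ ℓ ∧ 1 ≤ s ∧ 2 ≤ a ∧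
            IsSTPP A B C ∧ (∀ i, (A i).card = a ∧ (B i).card = a ^ k ∧ (C i).card = a) ∧
            (Fintype.card H : ℝ) ≤ s * (a : ℝ) ^ (((k : ℝ) + 1) * (1 + ε))) := by
  obtain ⟨δ, hδ, hδ1, hbar⟩ := exists_stpp_skinny_rpow_le ℓ
  refine ⟨δ, hδ, hδ1, fun k hk h => ?_⟩
  set κ : ℝ := (k : ℝ) + 1 with hκdef
  have hκ : 0 < κ := by positivity
  -- gap at `σ = 1`, and a tolerance small for BOTH the packing loss `κε` in `σ` and the budget
  set g : ℝ := δ - (κ * (1 - δ) - 2 * ((k : ℝ) + 2) / 3) with hgdef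
  have hg : 0 < g := by rw [hgdef]; linarith
  set ε : ℝ := g / (4 * κ) with hεdef
  have hε : 0 < ε := by positivity
  obtain ⟨H, _, _, _, s, a, A, B, C, hexp, hs, ha, hS, hcard, hH⟩ := h ε hε
  have ha0 : (0 : ℝ) < a := by exact_mod_cast (by omega : 0 < a)
  have ha1 : (1 : ℝ) < a := by exact_mod_cast ha
  have h1 := hbar H hexp k s a A B C hS hcard
  have h2 := rpow_pieces_le_of_barrier_of_budget hδ1 hs (by omega) h1 (Nat.cast_nonneg _) hH
  have hσs : (a : ℝ) ^ (1 - κ * ε) ≤ s := rpow_le_card_pieces_of_stpp_budget hS hs ha hcard hH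
  have h3 : (a : ℝ) ^ ((1 - κ * ε) * δ) ≤ (s : ℝ) ^ δ := by
    rw [Real.rpow_mul ha0.le]
    exact Real.rpow_le_rpow (Real.rpow_nonneg ha0.le _) hσs hδ.le
  have h5 : (1 - κ * ε) * δ ≤ κ * (1 + ε) * (1 - δ) - 2 * ((k : ℝ) + 2) / 3 :=
    (Real.rpow_le_rpow_left_iff ha1).mp (h3.trans h2)
  have h6 : κ * ε = g / 4 := by
    rw [hεdef, mul_div_assoc', mul_comm κ g, mul_comm (4 : ℝ) κ, mul_comm g κ,
      mul_div_mul_left g 4 hκ.ne']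
  have h7 : κ * (1 + ε) = κ + g / 4 := by rw [mul_add, mul_one, h6]
  rw [h6, h7] at h5
  nlinarith [h5, hg, hδ, hδ1]

end Summit.MatrixMultiplication.MatrixMultiplication.Theorems.FarEdgeDescentSTPPSaturation
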